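import Summits.ValiantsHypothesis.ValiantsHypothesis.Theorems.LacunarySymmetroidMatrixDescartesCensusDoorA34DefiniteTriple
import Summits.ValiantsHypothesis.ValiantsHypothesis.Theorems.LacunarySymmetroidMatrixDescartesCensusDoorA34DiagonalTriple

/-!
# `MatrixDescartes` census — DOOR A at `(3,4)`: the DEFINITE-COMBINATION LAW (a definite positive combination of two letters forces `V ≥ 2`)

HONEST FRAMING.  Object-search cell `pub-symmetroid`, door-A seat `val-sym-door-p3` (g14); helper file beside the OPEN typed statement
`DoorA34 = PosRootLawAt 3 4 18` (route item `Theses.LacunarySymmetroid.DoorA34`, stmt-ValiantsHypothesis-19980), asserted nowhere here.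
Third instalment of the seat's inertia laws (…DefiniteLetter: one definite LETTER; …DefiniteTriple: the triple sign).  This file treats an edge
`{a,b}` of the monomial tetrahedron on which neither letter is positive definite but some POSITIVE combination `y_a S_a + y_b S_b` (`y_a, y_b > 0`) is:
by `Census.exists_common_congruence` the two letters are then SIMULTANEOUSLY congruent to diagonal matrices `diag α`, `diag β` with
`y_a α_i + y_b β_i = 1`, so the edge cubic splits into real linear factors and the seat's diagonal edge law (`Census.diag_edge_count`, …DiagonalTriple)
makes Descartes EXACT on the edge: for a nineteen the edge count `V_ab` (the number of odd rank sums `ρ(3d_a)+ρ(2d_a+d_b)`, `ρ(2d_a+d_b)+ρ(2d_b+d_a)`,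
`ρ(2d_b+d_a)+ρ(3d_b)`) equals the number of `i` with `α_i β_i < 0`.  Since `S_a ⊁ 0` some `α_i < 0` (then `β_i > 0`) and since `S_b ⊁ 0` some `β_j < 0`
(then `α_j > 0`): **`V_ab ≥ 2`**.
* `card_posRoots_le_18_of_posDef_combination` — THE LAW (all supports): if `y_a S_a + y_b S_b ≻ 0` for some `y_a, y_b > 0`, neither `S_a` nor `S_b` is
  positive definite, and `V_ab ≤ 1`, then `Z₊ ≤ 18`; `card_posRoots_le_18_of_negDef_combination` is the mirror statement (`≺ 0`, neither letter
  negative definite).  Read contrapositively: in a NINETEEN, on every edge with `V_ab(d) ≤ 1` the open cone `{y_a S_a + y_b S_b : y > 0}` avoids BOTH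
  definite cones unless a letter on it is itself definite (where …DefiniteLetter takes over) — a constraint on the all-indefinite word `IIII` as well,
  and on EVERY support: located (this seat, `d₃ ≤ 30`), 5750 of the 12360 pairs (support, edge) have `V ≤ 1` and every one of the 2060 sorted
  3-Sidon supports has such an edge (e.g. `{0,2}` (`V = 0`) and `{0,3}` (`V = 1`) on `(0,1,7,11)`).
* `posRootCount_neg` — negating all letters keeps the count (used for the mirror statement);
* instance `card_posRoots_le_18_of_definite_combination_on_0_1_7_11`: on `(0,1,7,11)` a definite positive combination on the edge `{0,2}` or
  `{0,3}` kills the nineteen outright (a definite letter being handled by …DefiniteLetter).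
Nothing here bounds `ζ_sym(3,4)`; `DoorA34` stays OPEN; nothing on `MatrixDescartes` (stmt-18050) / `VP ≠ VNP`.
[folklore] simultaneous diagonalisation of a pencil with a definite member; Descartes' rule; elementary.
-/

open Polynomial Finset Matrix

-- `Summit.ValiantsHypothesis.ValiantsHypothesis.…` repeats a component by the D-0017 layout
-- (single-conjunct summit), which the `dupNamespace` linter flags; the name is mandated.
set_option linter.dupNamespace false

namespace Summit.ValiantsHypothesis.ValiantsHypothesis.Theorems.LacunarySymmetroidMatrixDescartes.Census

open Summit.ValiantsHypothesis.ValiantsHypothesis.Theorems.LacunarySymmetroidMatrixDescartes.Census.SignSplit (posRootCount)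

/-- Negating every letter does not change the number of distinct positive determinant roots. [folklore] -/
theorem posRootCount_neg (d : Fin 4 → ℕ) (S : Fin 4 → Matrix (Fin 3) (Fin 3) ℝ) :
    posRootCount d (fun l => -S l) = posRootCount d S := by
  have h := SpanRank.posRootCount_conj d S (-1) 1 (by simp [Matrix.det_neg, Fintype.card_fin]) (by simp)
  simpa using h

/-- **DEFINITE-COMBINATION LAW (positive definite case, all supports).**  If a positive combination `y_a S_a + y_b S_b` (`y_a, y_b > 0`) of two letters
is positive definite while neither `S_a` nor `S_b` is, and the edge count `V_ab` of the support is `≤ 1`, the determinant has at most `18` distinct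
positive roots. [folklore] -/
theorem card_posRoots_le_18_of_posDef_combination (d : Fin 4 → ℕ) (S : Fin 4 → Matrix (Fin 3) (Fin 3) ℝ) (hS : ∀ l, (S l).IsSymm)
    {a b : Fin 4} (hab : a ≠ b) (ya yb : ℝ) (hya : 0 < ya) (hyb : 0 < yb) (hcomb : (ya • S a + yb • S b).PosDef)
    (hna : ¬ (S a).PosDef) (hnb : ¬ (S b).PosDef)
    (ρ : ℕ → ℕ) (hρ : ∀ e, ρ e = (((Finset.univ : Finset (Fin 4 × Fin 4 × Fin 4)).image
      (fun p => d p.1 + d p.2.1 + d p.2.2)).filter (· < e)).card)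
    (hV : (ρ (3 * d a) + ρ (2 * d a + d b)) % 2 + (ρ (2 * d a + d b) + ρ (2 * d b + d a)) % 2
        + (ρ (2 * d b + d a) + ρ (3 * d b)) % 2 ≤ 1) :
    ((Matrix.det (∑ l, ((X : ℝ[X]) ^ d l) • (S l).map C)).roots.toFinset.filter (fun t => 0 < t)).card ≤ 18 := by
  classical
  have hHb : (S b).IsHermitian := by unfold Matrix.IsHermitian; rw [conjTranspose_eq_transpose_of_trivial]; exact hS b
  obtain ⟨Y, β, hYdet, hPY, hbY⟩ := exists_common_congruence hcomb hHb
  have hYdu : IsUnit Y.det := isUnit_iff_ne_zero.mpr hYdet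
  have hYiu : IsUnit Y⁻¹ := (isUnit_iff_isUnit_det _).mpr (isUnit_nonsing_inv_det Y hYdu)
  have hst : star Y = Yᵀ := by rw [star_eq_conjTranspose, conjTranspose_eq_transpose_of_trivial]
  have hcancel : star (Y⁻¹) * star Y = 1 := by rw [← star_mul, mul_nonsing_inv Y hYdu, star_one]
  have hcancel' : Y * Y⁻¹ = 1 := mul_nonsing_inv Y hYdu
  -- the first letter in the common frame
  set α : Fin 3 → ℝ := fun i => ya⁻¹ * (1 - yb * β i) with hαdef
  have hαβ : ∀ i, ya * α i + yb * β i = 1 := fun i => by simp only [hαdef]; field_simp; ring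
  have haY : S a = star Y * diagonal α * Y := by
    have h1 : S a = ya⁻¹ • ((ya • S a + yb • S b) - yb • S b) := by
      rw [add_sub_cancel_right, smul_smul, inv_mul_cancel₀ hya.ne', one_smul]
    have hdiag : ya⁻¹ • ((1 : Matrix (Fin 3) (Fin 3) ℝ) - yb • diagonal β) = diagonal α := by
      ext i j
      by_cases h : i = j
      · subst h; simp [hαdef]
      · simp [diagonal_apply_ne _ h, Matrix.one_apply_ne h]
    rw [h1, hPY, hbY, ← hdiag]
    simp only [Matrix.mul_smul, Matrix.smul_mul, Matrix.mul_sub, Matrix.sub_mul, Matrix.mul_one, smul_sub]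
  -- the congruent pencil `S'`
  set S' : Fin 4 → Matrix (Fin 3) (Fin 3) ℝ := fun l => star (Y⁻¹) * S l * Y⁻¹ with hS'def
  have hback : ∀ l, S l = Yᵀ * S' l * Y := fun l => by
    rw [hS'def, ← hst]
    calc S l = star (Y⁻¹ * Y) * S l * (Y⁻¹ * Y) := by rw [nonsing_inv_mul Y hYdu, star_one, one_mul, mul_one]
      _ = star Y * (star Y⁻¹ * S l * Y⁻¹) * Y := by rw [star_mul]; simp only [Matrix.mul_assoc]
  have hS'a : S' a = diagonal α := by
    simp only [hS'def]; rw [haY]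
    calc star Y⁻¹ * (star Y * diagonal α * Y) * Y⁻¹ = (star Y⁻¹ * star Y) * diagonal α * (Y * Y⁻¹) := by
          simp only [Matrix.mul_assoc]
      _ = diagonal α := by rw [hcancel, hcancel', one_mul, mul_one]
  have hS'b : S' b = diagonal β := by
    simp only [hS'def]; rw [hbY]
    calc star Y⁻¹ * (star Y * diagonal β * Y) * Y⁻¹ = (star Y⁻¹ * star Y) * diagonal β * (Y * Y⁻¹) := by
          simp only [Matrix.mul_assoc]
      _ = diagonal β := by rw [hcancel, hcancel', one_mul, mul_one]
  have hcount : posRootCount d S = posRootCount d S' := by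
    have hfun : S = fun l => Yᵀ * S' l * Yᵀᵀ := by funext l; rw [transpose_transpose]; exact hback l
    rw [hfun]; exact SpanRank.posRootCount_congr d S' Yᵀ (by rwa [det_transpose])
  change posRootCount d S ≤ 18
  rw [hcount]
  by_contra hlt; push Not at hlt
  have h19 : 19 ≤ ((Matrix.det (∑ l, ((X : ℝ[X]) ^ d l) • (S' l).map C)).roots.toFinset.filter (fun t => 0 < t)).card := by
    change 19 ≤ posRootCount d S'; omega
  -- edge count in the diagonal frame
  have hdiag_a : ∀ u v : Fin 3, u ≠ v → S' a u v = 0 := fun u v huv => by rw [hS'a, diagonal_apply_ne _ huv]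
  have hdiag_b : ∀ u v : Fin 3, u ≠ v → S' b u v = 0 := fun u v huv => by rw [hS'b, diagonal_apply_ne _ huv]
  have hedge := diag_edge_count d S' hab hdiag_a hdiag_b h19 ρ hρ
  rw [hS'a, hS'b] at hedge
  simp only [diagonal_apply_eq] at hedge
  -- a negative `α_i` and a negative `β_j`
  have hdeta : (diagonal α).det ≠ 0 := by rw [← hS'a]; exact det_letter_ne_zero_of_nineteen d S' h19 a
  have hdetb : (diagonal β).det ≠ 0 := by rw [← hS'b]; exact det_letter_ne_zero_of_nineteen d S' h19 b
  rw [det_diagonal] at hdeta hdetb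
  have hαne : ∀ i, α i ≠ 0 := fun i => (Finset.prod_ne_zero_iff.mp hdeta) i (Finset.mem_univ i)
  have hβne : ∀ i, β i ≠ 0 := fun i => (Finset.prod_ne_zero_iff.mp hdetb) i (Finset.mem_univ i)
  have hYu : IsUnit Y := (isUnit_iff_isUnit_det Y).mpr hYdu
  have hαneg : ∃ i, α i < 0 := by
    by_contra h; push Not at h
    have hpos : ∀ i, 0 < α i := fun i => lt_of_le_of_ne (h i) (hαne i).symm
    exact hna (by rw [haY]; exact hYu.posDef_star_left_conjugate_iff.mpr (posDef_diagonal_iff.mpr hpos))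
  have hβneg : ∃ j, β j < 0 := by
    by_contra h; push Not at h
    have hpos : ∀ i, 0 < β i := fun i => lt_of_le_of_ne (h i) (hβne i).symm
    exact hnb (by rw [hbY]; exact hYu.posDef_star_left_conjugate_iff.mpr (posDef_diagonal_iff.mpr hpos))
  obtain ⟨i, hi⟩ := hαneg
  obtain ⟨j, hj⟩ := hβneg
  have hβi : 0 < β i := by nlinarith [hαβ i]
  have hαj : 0 < α j := by nlinarith [hαβ j]
  have pi : α i * β i < 0 := mul_neg_of_neg_of_pos hi hβi
  have pj : α j * β j < 0 := mul_neg_of_pos_of_neg hαj hj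
  have hij : i ≠ j := fun h => by rw [h] at hβi; exact absurd hj (not_lt.mpr hβi.le)
  have hsum : (if α 0 * β 0 < 0 then 1 else 0) + (if α 1 * β 1 < 0 then 1 else 0) + (if α 2 * β 2 < 0 then 1 else 0)
      = ∑ u : Fin 3, (if α u * β u < 0 then 1 else 0 : ℕ) := by rw [Fin.sum_univ_three]
  have h2 : 2 ≤ ∑ u : Fin 3, (if α u * β u < 0 then 1 else 0 : ℕ) :=
    calc 2 = ∑ u ∈ ({i, j} : Finset (Fin 3)), (if α u * β u < 0 then 1 else 0 : ℕ) := by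
          rw [Finset.sum_pair hij, if_pos pi, if_pos pj]
      _ ≤ _ := Finset.sum_le_sum_of_subset (Finset.subset_univ _)
  omega

/-- **DEFINITE-COMBINATION LAW (negative definite case).**  The mirror statement: a negative definite positive combination of two letters, neither of
which is negative definite, forces `V_ab ≥ 2` in a nineteen. [folklore] -/
theorem card_posRoots_le_18_of_negDef_combination (d : Fin 4 → ℕ) (S : Fin 4 → Matrix (Fin 3) (Fin 3) ℝ) (hS : ∀ l, (S l).IsSymm)
    {a b : Fin 4} (hab : a ≠ b) (ya yb : ℝ) (hya : 0 < ya) (hyb : 0 < yb) (hcomb : (-(ya • S a + yb • S b)).PosDef)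
    (hna : ¬ (-S a).PosDef) (hnb : ¬ (-S b).PosDef)
    (ρ : ℕ → ℕ) (hρ : ∀ e, ρ e = (((Finset.univ : Finset (Fin 4 × Fin 4 × Fin 4)).image
      (fun p => d p.1 + d p.2.1 + d p.2.2)).filter (· < e)).card)
    (hV : (ρ (3 * d a) + ρ (2 * d a + d b)) % 2 + (ρ (2 * d a + d b) + ρ (2 * d b + d a)) % 2
        + (ρ (2 * d b + d a) + ρ (3 * d b)) % 2 ≤ 1) :
    ((Matrix.det (∑ l, ((X : ℝ[X]) ^ d l) • (S l).map C)).roots.toFinset.filter (fun t => 0 < t)).card ≤ 18 := by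
  have hcomb' : (ya • (-S a) + yb • (-S b)).PosDef := by rwa [smul_neg, smul_neg, ← neg_add]
  have h := card_posRoots_le_18_of_posDef_combination d (fun l => -S l) (fun l => (hS l).neg) hab ya yb hya hyb hcomb' hna hnb ρ hρ hV
  change posRootCount d S ≤ 18
  rw [← posRootCount_neg]; exact h

/-- **`(0,1,7,11)`: a definite positive combination on a low edge kills the nineteen.**  On the support `(0,1,7,11)` (edge counts
`V = ![![0, 3, 0, 1], ![3, 0, 3, 2], ![0, 3, 0, 3], ![1, 2, 3, 0]]`), if for an edge `{a,b}` with `V_ab ≤ 1` — i.e. `{0,2}` (`V = 0`) or `{0,3}` (`V = 1`) — some positive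
combination `y_a S_a + y_b S_b` is positive or negative definite, then `Z₊ ≤ 18` (no hypothesis on the letters: a definite letter is handled by
`card_posRoots_le_18_of_definite_letter_on_0_1_7_11`). [folklore] -/
theorem card_posRoots_le_18_of_definite_combination_on_0_1_7_11 (S : Fin 4 → Matrix (Fin 3) (Fin 3) ℝ) (hS : ∀ l, (S l).IsSymm)
    {a b : Fin 4} (hab : a ≠ b) (hlow : (![![0, 3, 0, 1], ![3, 0, 3, 2], ![0, 3, 0, 3], ![1, 2, 3, 0]] : Fin 4 → Fin 4 → ℕ) a b ≤ 1)
    (ya yb : ℝ) (hya : 0 < ya) (hyb : 0 < yb) (hcomb : (ya • S a + yb • S b).PosDef ∨ (-(ya • S a + yb • S b)).PosDef) :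
    ((Matrix.det (∑ l, ((X : ℝ[X]) ^ ((![0, 1, 7, 11] : Fin 4 → ℕ)) l) • (S l).map C)).roots.toFinset.filter (fun t => 0 < t)).card
      ≤ 18 := by
  by_cases hda : (S a).PosDef ∨ (-S a).PosDef
  · exact card_posRoots_le_18_of_definite_letter_on_0_1_7_11 S hS a hda
  by_cases hdb : (S b).PosDef ∨ (-S b).PosDef
  · exact card_posRoots_le_18_of_definite_letter_on_0_1_7_11 S hS b hdb
  push Not at hda hdb
  have hT : ((Finset.univ : Finset (Fin 4 × Fin 4 × Fin 4)).image
      (fun p => (![0, 1, 7, 11] : Fin 4 → ℕ) p.1 + (![0, 1, 7, 11] : Fin 4 → ℕ) p.2.1 + (![0, 1, 7, 11] : Fin 4 → ℕ) p.2.2))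
        = ({0, 1, 2, 3, 7, 8, 9, 11, 12, 13, 14, 15, 18, 19, 21, 22, 23, 25, 29, 33} : Finset ℕ) := by decide
  have hVtab : ∀ x y : Fin 4, x ≠ y → (![![0, 3, 0, 1], ![3, 0, 3, 2], ![0, 3, 0, 3], ![1, 2, 3, 0]] : Fin 4 → Fin 4 → ℕ) x y
      = ((({0, 1, 2, 3, 7, 8, 9, 11, 12, 13, 14, 15, 18, 19, 21, 22, 23, 25, 29, 33} : Finset ℕ).filter (· < 3 * (![0, 1, 7, 11] : Fin 4 → ℕ) x)).card
          + (({0, 1, 2, 3, 7, 8, 9, 11, 12, 13, 14, 15, 18, 19, 21, 22, 23, 25, 29, 33} : Finset ℕ).filter (· < 2 * (![0, 1, 7, 11] : Fin 4 → ℕ) x + (![0, 1, 7, 11] : Fin 4 → ℕ) y)).card) % 2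
        + ((({0, 1, 2, 3, 7, 8, 9, 11, 12, 13, 14, 15, 18, 19, 21, 22, 23, 25, 29, 33} : Finset ℕ).filter (· < 2 * (![0, 1, 7, 11] : Fin 4 → ℕ) x + (![0, 1, 7, 11] : Fin 4 → ℕ) y)).card
          + (({0, 1, 2, 3, 7, 8, 9, 11, 12, 13, 14, 15, 18, 19, 21, 22, 23, 25, 29, 33} : Finset ℕ).filter (· < 2 * (![0, 1, 7, 11] : Fin 4 → ℕ) y + (![0, 1, 7, 11] : Fin 4 → ℕ) x)).card) % 2
        + ((({0, 1, 2, 3, 7, 8, 9, 11, 12, 13, 14, 15, 18, 19, 21, 22, 23, 25, 29, 33} : Finset ℕ).filter (· < 2 * (![0, 1, 7, 11] : Fin 4 → ℕ) y + (![0, 1, 7, 11] : Fin 4 → ℕ) x)).card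
          + (({0, 1, 2, 3, 7, 8, 9, 11, 12, 13, 14, 15, 18, 19, 21, 22, 23, 25, 29, 33} : Finset ℕ).filter (· < 3 * (![0, 1, 7, 11] : Fin 4 → ℕ) y)).card) % 2 := by
    decide
  rw [hVtab a b hab] at hlow
  rcases hcomb with hc | hc
  · exact card_posRoots_le_18_of_posDef_combination _ S hS hab ya yb hya hyb hc hda.1 hdb.1
      (fun e => ((({0, 1, 2, 3, 7, 8, 9, 11, 12, 13, 14, 15, 18, 19, 21, 22, 23, 25, 29, 33} : Finset ℕ)).filter (· < e)).card) (fun e => by rw [hT]) hlow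
  · exact card_posRoots_le_18_of_negDef_combination _ S hS hab ya yb hya hyb hc hda.2 hdb.2
      (fun e => ((({0, 1, 2, 3, 7, 8, 9, 11, 12, 13, 14, 15, 18, 19, 21, 22, 23, 25, 29, 33} : Finset ℕ)).filter (· < e)).card) (fun e => by rw [hT]) hlow

/-! ## Appendix: the mixed quadrant — a definite DIFFERENCE of two letters forces `V ≤ 1` -/

/-- **DEFINITE-DIFFERENCE LAW (all supports).**  If a difference `y_a S_a − y_b S_b` (`y_a, y_b > 0`) is positive definite while `S_a` is not
positive definite and `S_b` is not negative definite, then in the common congruence frame `y_a α_i − y_b β_i = 1`, a negative `α_i` forces a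
negative `β_i` and a positive `β_j` forces a positive `α_j`: at most ONE index carries opposite signs, so a nineteen needs `V_ab ≤ 1`; hence
`V_ab ≥ 2 ⇒ Z₊ ≤ 18`.  With `card_posRoots_le_18_of_posDef_combination`: for two indefinite letters whose pencil contains a definite matrix, the
quadrant of the definite cone is dictated by `V_ab(d)` (same-sign quadrant iff `V_ab ≥ 2`). [folklore] -/
theorem card_posRoots_le_18_of_posDef_difference (d : Fin 4 → ℕ) (S : Fin 4 → Matrix (Fin 3) (Fin 3) ℝ) (hS : ∀ l, (S l).IsSymm)
    {a b : Fin 4} (hab : a ≠ b) (ya yb : ℝ) (hya : 0 < ya) (hyb : 0 < yb) (hcomb : (ya • S a - yb • S b).PosDef)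
    (hna : ¬ (S a).PosDef) (hnb : ¬ (-S b).PosDef)
    (ρ : ℕ → ℕ) (hρ : ∀ e, ρ e = (((Finset.univ : Finset (Fin 4 × Fin 4 × Fin 4)).image
      (fun p => d p.1 + d p.2.1 + d p.2.2)).filter (· < e)).card)
    (hV : 2 ≤ (ρ (3 * d a) + ρ (2 * d a + d b)) % 2 + (ρ (2 * d a + d b) + ρ (2 * d b + d a)) % 2
        + (ρ (2 * d b + d a) + ρ (3 * d b)) % 2) :
    ((Matrix.det (∑ l, ((X : ℝ[X]) ^ d l) • (S l).map C)).roots.toFinset.filter (fun t => 0 < t)).card ≤ 18 := by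
  classical
  have hHb : (S b).IsHermitian := by unfold Matrix.IsHermitian; rw [conjTranspose_eq_transpose_of_trivial]; exact hS b
  obtain ⟨Y, β, hYdet, hPY, hbY⟩ := exists_common_congruence hcomb hHb
  have hYdu : IsUnit Y.det := isUnit_iff_ne_zero.mpr hYdet
  have hYu : IsUnit Y := (isUnit_iff_isUnit_det Y).mpr hYdu
  have hst : star Y = Yᵀ := by rw [star_eq_conjTranspose, conjTranspose_eq_transpose_of_trivial]
  have hcancel : star (Y⁻¹) * star Y = 1 := by rw [← star_mul, mul_nonsing_inv Y hYdu, star_one]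
  have hcancel' : Y * Y⁻¹ = 1 := mul_nonsing_inv Y hYdu
  set α : Fin 3 → ℝ := fun i => ya⁻¹ * (1 + yb * β i) with hαdef
  have hαβ : ∀ i, ya * α i - yb * β i = 1 := fun i => by simp only [hαdef]; field_simp; ring
  have haY : S a = star Y * diagonal α * Y := by
    have h1 : S a = ya⁻¹ • ((ya • S a - yb • S b) + yb • S b) := by
      rw [sub_add_cancel, smul_smul, inv_mul_cancel₀ hya.ne', one_smul]
    have hdiag : ya⁻¹ • ((1 : Matrix (Fin 3) (Fin 3) ℝ) + yb • diagonal β) = diagonal α := by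
      ext i j
      by_cases h : i = j
      · subst h; simp [hαdef]
      · simp [diagonal_apply_ne _ h, Matrix.one_apply_ne h]
    rw [h1, hPY, hbY, ← hdiag]
    simp only [Matrix.mul_smul, Matrix.smul_mul, Matrix.mul_add, Matrix.add_mul, Matrix.mul_one, smul_add]
  set S' : Fin 4 → Matrix (Fin 3) (Fin 3) ℝ := fun l => star (Y⁻¹) * S l * Y⁻¹ with hS'def
  have hback : ∀ l, S l = Yᵀ * S' l * Y := fun l => by
    rw [hS'def, ← hst]
    calc S l = star (Y⁻¹ * Y) * S l * (Y⁻¹ * Y) := by rw [nonsing_inv_mul Y hYdu, star_one, one_mul, mul_one]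
      _ = star Y * (star Y⁻¹ * S l * Y⁻¹) * Y := by rw [star_mul]; simp only [Matrix.mul_assoc]
  have hS'a : S' a = diagonal α := by
    simp only [hS'def]; rw [haY]
    calc star Y⁻¹ * (star Y * diagonal α * Y) * Y⁻¹ = (star Y⁻¹ * star Y) * diagonal α * (Y * Y⁻¹) := by
          simp only [Matrix.mul_assoc]
      _ = diagonal α := by rw [hcancel, hcancel', one_mul, mul_one]
  have hS'b : S' b = diagonal β := by
    simp only [hS'def]; rw [hbY]
    calc star Y⁻¹ * (star Y * diagonal β * Y) * Y⁻¹ = (star Y⁻¹ * star Y) * diagonal β * (Y * Y⁻¹) := by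
          simp only [Matrix.mul_assoc]
      _ = diagonal β := by rw [hcancel, hcancel', one_mul, mul_one]
  have hcount : posRootCount d S = posRootCount d S' := by
    have hfun : S = fun l => Yᵀ * S' l * Yᵀᵀ := by funext l; rw [transpose_transpose]; exact hback l
    rw [hfun]; exact SpanRank.posRootCount_congr d S' Yᵀ (by rwa [det_transpose])
  change posRootCount d S ≤ 18
  rw [hcount]
  by_contra hlt; push Not at hlt
  have h19 : 19 ≤ ((Matrix.det (∑ l, ((X : ℝ[X]) ^ d l) • (S' l).map C)).roots.toFinset.filter (fun t => 0 < t)).card := by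
    change 19 ≤ posRootCount d S'; omega
  have hdiag_a : ∀ u v : Fin 3, u ≠ v → S' a u v = 0 := fun u v huv => by rw [hS'a, diagonal_apply_ne _ huv]
  have hdiag_b : ∀ u v : Fin 3, u ≠ v → S' b u v = 0 := fun u v huv => by rw [hS'b, diagonal_apply_ne _ huv]
  have hedge := diag_edge_count d S' hab hdiag_a hdiag_b h19 ρ hρ
  rw [hS'a, hS'b] at hedge
  simp only [diagonal_apply_eq] at hedge
  have hdeta : (diagonal α).det ≠ 0 := by rw [← hS'a]; exact det_letter_ne_zero_of_nineteen d S' h19 a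
  have hdetb : (diagonal β).det ≠ 0 := by rw [← hS'b]; exact det_letter_ne_zero_of_nineteen d S' h19 b
  rw [det_diagonal] at hdeta hdetb
  have hαne : ∀ i, α i ≠ 0 := fun i => (Finset.prod_ne_zero_iff.mp hdeta) i (Finset.mem_univ i)
  have hβne : ∀ i, β i ≠ 0 := fun i => (Finset.prod_ne_zero_iff.mp hdetb) i (Finset.mem_univ i)
  have hαneg : ∃ i, α i < 0 := by
    by_contra h; push Not at h
    have hpos : ∀ i, 0 < α i := fun i => lt_of_le_of_ne (h i) (hαne i).symm
    exact hna (by rw [haY]; exact hYu.posDef_star_left_conjugate_iff.mpr (posDef_diagonal_iff.mpr hpos))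
  have hβpos : ∃ j, 0 < β j := by
    by_contra h; push Not at h
    have hneg : ∀ i, 0 < -β i := fun i => by have := lt_of_le_of_ne (h i) (hβne i); linarith
    refine hnb ?_
    rw [hbY, show -(star Y * diagonal β * Y) = star Y * diagonal (fun i => -β i) * Y by
      rw [← diagonal_neg, Matrix.mul_neg, Matrix.neg_mul]]
    exact hYu.posDef_star_left_conjugate_iff.mpr (posDef_diagonal_iff.mpr hneg)
  obtain ⟨i, hi⟩ := hαneg
  obtain ⟨j, hj⟩ := hβpos
  have hβi : β i < 0 := by nlinarith [hαβ i]
  have hαj : 0 < α j := by nlinarith [hαβ j]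
  have pi : ¬ α i * β i < 0 := not_lt.mpr (mul_pos_of_neg_of_neg hi hβi).le
  have pj : ¬ α j * β j < 0 := not_lt.mpr (mul_pos hαj hj).le
  have hij : i ≠ j := fun h => by rw [h] at hβi; exact absurd hj (not_lt.mpr hβi.le)
  -- the three indicator terms: those at `i ≠ j` vanish, the third is `≤ 1`
  have hsum : (if α 0 * β 0 < 0 then 1 else 0) + (if α 1 * β 1 < 0 then 1 else 0) + (if α 2 * β 2 < 0 then 1 else 0)
      = ∑ u : Fin 3, (if α u * β u < 0 then 1 else 0 : ℕ) := by rw [Fin.sum_univ_three]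
  have hle : ∑ u : Fin 3, (if α u * β u < 0 then 1 else 0 : ℕ) ≤ 1 := by
    have hsplit := Finset.sum_le_sum_of_subset_of_nonneg (f := fun u : Fin 3 => (if α u * β u < 0 then 1 else 0 : ℕ))
      (Finset.subset_univ ({i, j}ᶜ : Finset (Fin 3))) (fun _ _ _ => Nat.zero_le _)
    have hcard : (({i, j} : Finset (Fin 3))ᶜ).card = 1 := by
      rw [Finset.card_compl, Finset.card_pair hij]; simp
    obtain ⟨k, hk⟩ := Finset.card_eq_one.mp hcard
    have hrest : ∑ u ∈ ({i, j} : Finset (Fin 3))ᶜ, (if α u * β u < 0 then 1 else 0 : ℕ) ≤ 1 := by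
      rw [hk, Finset.sum_singleton]; split_ifs <;> omega
    have htot : ∑ u : Fin 3, (if α u * β u < 0 then 1 else 0 : ℕ)
        = ∑ u ∈ ({i, j} : Finset (Fin 3))ᶜ, (if α u * β u < 0 then 1 else 0 : ℕ)
          + ∑ u ∈ ({i, j} : Finset (Fin 3)), (if α u * β u < 0 then 1 else 0 : ℕ) := by
      rw [Finset.sum_compl_add_sum]
    rw [htot, Finset.sum_pair hij, if_neg pi, if_neg pj]; omega
  omega

end Summit.ValiantsHypothesis.ValiantsHypothesis.Theorems.LacunarySymmetroidMatrixDescartes.Census
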